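import Summits.NavierStokesRegularity.NavierStokesRegularity.Theorems.ScenarioCensusRowD9Kernel
import HarnessLib

/-!
# Census row D9 TYPED — part 3/9: the power law (§6) — Chae's Type-II power laws are stationary modulations, Leray's
# rate is not, stationary ⇒ Type II; F4b′ is the power-law member of D9 (`row_F4bp_of_row_D9K`, `row_F4bpLH_of_row_D9LH`);
# the rung on power laws (`row_D9Sharp_chae`, `row_F4bSharp_holds'`, `row_F4b_holds''`); LINE 15's `RateGate` from the CORE

Re-homed for the scenario census (typer seat ns-census-typer-1 g7; in scope of the census KEY text «one `def Row_<k> : Prop`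
per OPEN row» — row D9 was the one OPEN-NO-LINE row without a typed tree decl, typer-1 g6 HANDOFF 19:50Z; lead programme ended
at v1.67, base SUMMON-only; ANNOUNCE on the cell STATUS 2026-08-28T20:24Z): VERBATIM PORT of ns-idea-9 LINE 16 «modulation_gate»
rev 5, `pub/ideators/ns-idea-9/lines/modulation_gate/modulation_gate.lean` sha16 1d7b2cd493e504e0 (2259 l., lean check rc 0,
0 sorry; critic idea-crit-8 V66/V67/V69 PASS-WITH-PRICE on rev 1–4, ref ns-census-ref g8 PRE-CHECK ✓ §13.14 [5/6] of rev 4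
f704279be2039922; rev 5 = rev 4 + §6e «S0 proved»; TARGET-MENU r4 names this line as row D9's lever; CENSUS-FINAL r6 §2 lists
`row_F4bp_of_row_D9K` / `row_F4bpLH_of_row_D9LH` as FILES-ONLY edges), split for the 400-line rule into
`ScenarioCensusRowD9Modulation` (§1–§4) → `…RowD9Kernel` (§5) → `…RowD9PowerLaw` (§6) → `…RowD9CoreExponents` (§6c (i)–(iv)) →
`…RowD9Core` (§6c (v)) → `…RowD9DissipationTools` (§6d, first half) → `…RowD9Dissipation` (§6d, second half) →
`…RowD9SteadyLimitTools` (§6e, first half) → `…RowD9` (§6e, second half; §7; census KEYS).  Lean text VERBATIM in namespace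
`…Theorems.ScenarioCensus.ModulationGate` (the line's `…Cruxes.Row_F4bp.ModulationGate` re-homed); port edits: the two
`local notation "E3"` lines → `abbrev E3` (typer lint: no notation in port files), `@[conjecture]` added to the four OPEN
parameterless `def`s `Row_D9K` / `Row_D9LH` / `Row_D9LHWild` / `Row_F4bpLH` (obligation nodes), one-line docstrings added to twelve undocumented auxiliaries, the three
`@[deprecated] stub_*` aliases of §7 not re-declared, four §7 docstrings updated to the rev-5 facts (everything proved).

No census value is asserted here (a summoned lead books row D9; FILES-ONLY edges become TREE by name); NS regularity is NOT
proved; rows D9 / F4b′ stay OPEN (= their wild residuals, by theorem); no summit statement is proved by this file.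
-/

-- the summit and its single problem share the name `NavierStokesRegularity` (D-0017 nested layout)
set_option linter.dupNamespace false

noncomputable section

open Set Function Filter Topology MeasureTheory Metric
open scoped NNReal ENNReal ContDiff

namespace Summit.NavierStokesRegularity.NavierStokesRegularity.Theorems.ScenarioCensus.ModulationGate

open Literature.Analysis Literature.Analysis.FluidPDE
open Summit.NavierStokesRegularity.NavierStokesRegularity.Theorems.ScenarioCensus

/-! ## §6 The power law: F4b′ is the Chae member of D9 (PROVED) -/

section PowerLaw

/-- `(T − t)^q → 0` as `t ↑ T` for `q > 0`. [folklore] -/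
theorem tendsto_rpow_sub_nhdsLT (T : ℝ) {q : ℝ} (hq : 0 < q) :
    Tendsto (fun t : ℝ => (T - t) ^ q) (𝓝[<] T) (𝓝 0) := by
  have h0 : Tendsto (fun t : ℝ => T - t) (𝓝[<] T) (𝓝 0) :=
    tendsto_nhdsWithin_of_tendsto_nhds
      ((continuous_const.sub continuous_id).tendsto' T 0 (by simp))
  have h := ((Real.continuousAt_rpow_const 0 q (Or.inr hq.le)).tendsto).comp h0
  rwa [Function.comp_def, Real.zero_rpow hq.ne'] at h

/-- `μ = λ⁻²` of the power law is `(T−t)^γ` for `t < T`. -/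
theorem chaeModulation_sq_inv {T γ t : ℝ} (ht : t < T) :
    ((chaeModulation T γ t) ^ 2)⁻¹ = (T - t) ^ γ := by
  have hd : 0 ≤ T - t := (sub_pos.2 ht).le
  unfold chaeModulation
  rw [inv_pow, inv_inv, ← Real.rpow_mul_natCast hd]
  congr 1
  push_cast
  ring

/-- **Chae's Type-II power laws are profile-stationary modulations** (`γ > 1`; `μ = (T−t)^γ`,
`μ′ = −γ(T−t)^{γ−1} → 0`). [cite: Chae2010, arXiv:0711.1113 §2 (the choice μ(t) = (T−t)^{−γ}, γ > 1)] -/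
theorem isStationaryModulation_chae {T γ : ℝ} (hγ : 1 < γ) :
    IsStationaryModulation T (chaeModulation T γ) := by
  have hγ0 : 0 < γ := lt_trans zero_lt_one hγ
  refine ⟨?_, ?_⟩
  · -- `λ = ((T−t)^{γ/2})⁻¹ → ∞`
    have h0 : Tendsto (fun t : ℝ => (T - t) ^ (γ / 2)) (𝓝[<] T) (𝓝[>] 0) := by
      refine tendsto_nhdsWithin_iff.2 ⟨tendsto_rpow_sub_nhdsLT T (by positivity), ?_⟩
      exact eventually_nhdsWithin_of_forall fun t (ht : t < T) =>
        Real.rpow_pos_of_pos (sub_pos.2 ht) _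
    exact tendsto_inv_nhdsGT_zero.comp h0
  · refine ⟨fun t => (-1) * γ * (T - t) ^ (γ - 1), ?_, ?_⟩
    · refine eventually_nhdsWithin_of_forall fun t (ht : t < T) => ?_
      have hd : 0 < T - t := sub_pos.2 ht
      have hderiv : HasDerivAt (fun s : ℝ => (T - s) ^ γ) ((-1) * γ * (T - t) ^ (γ - 1)) t :=
        ((hasDerivAt_id t).const_sub T).rpow_const (Or.inl hd.ne')
      refine hderiv.congr_of_eventuallyEq ?_
      filter_upwards [Iio_mem_nhds ht] with s hs
      exact chaeModulation_sq_inv hs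
    · have h := (tendsto_rpow_sub_nhdsLT T (sub_pos.2 hγ)).const_mul ((-1) * γ)
      simpa using h

/-- **Leray's rate `γ = 1` is NOT profile-stationary** (`μ = T − t`, `μ′ ≡ −1`): the class begins
strictly above Type I. -/
theorem not_isStationaryModulation_leray {T : ℝ} : ¬ IsStationaryModulation T (chaeModulation T 1) := by
  rintro ⟨-, μ', hderiv, hlim⟩
  -- on `t < T`, `((λ t)^2)⁻¹ = T − t`, whose derivative is `−1`; so `μ' = −1` eventually, not `→ 0`.
  have hμ : ∀ᶠ t in 𝓝[<] T, μ' t = -1 := by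
    filter_upwards [hderiv, eventually_nhdsWithin_of_forall fun t (ht : t < T) => ht] with t ht hlt
    have h2 : HasDerivAt (fun s : ℝ => ((chaeModulation T 1 s) ^ 2)⁻¹) (-1) t := by
      have hlin : HasDerivAt (fun s : ℝ => T - s) (-1) t := by
        simpa using (hasDerivAt_id t).const_sub T
      refine hlin.congr_of_eventuallyEq ?_
      filter_upwards [Iio_mem_nhds hlt] with s hs
      rw [chaeModulation_sq_inv hs, Real.rpow_one]
    exact ht.unique h2
  have hlim' : Tendsto (fun _ : ℝ => (-1 : ℝ)) (𝓝[<] T) (𝓝 0) := hlim.congr' hμ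
  have := tendsto_nhds_unique hlim' tendsto_const_nhds
  norm_num at this

/-- A stationary modulation is eventually positive. -/
theorem IsStationaryModulation.eventually_pos {T : ℝ} {lam : ℝ → ℝ} (h : IsStationaryModulation T lam) :
    ∀ᶠ t in 𝓝[<] T, 0 < lam t :=
  h.tendsto_atTop.eventually (eventually_gt_atTop 0)

/-- `μ = λ⁻² → 0`. -/
theorem IsStationaryModulation.tendsto_mu_zero {T : ℝ} {lam : ℝ → ℝ} (h : IsStationaryModulation T lam) :
    Tendsto (fun t => ((lam t) ^ 2)⁻¹) (𝓝[<] T) (𝓝 0) :=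
  ((tendsto_pow_atTop two_ne_zero).comp h.tendsto_atTop).inv_tendsto_atTop

/-- **Stationary modulations are Type II** (census D9's defining condition `λ(t)√(T−t) → ∞`, squared):
`λ(t)²(T − t) → ∞`.  (Mean value inequality: `|μ′| ≤ ε` near `T` and `μ(T⁻) = 0` give `μ(t) ≤ ε(T−t)`.)
PROVED. -/
theorem IsStationaryModulation.typeII {T : ℝ} {lam : ℝ → ℝ} (h : IsStationaryModulation T lam) :
    Tendsto (fun t => (lam t) ^ 2 * (T - t)) (𝓝[<] T) atTop := by
  obtain ⟨μ', hder, hμ'⟩ := h.stationary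
  have hμ0 : Tendsto (fun s => ((lam s) ^ 2)⁻¹) (𝓝[<] T) (𝓝 0) := h.tendsto_mu_zero
  -- main estimate: for every `ε > 0`, eventually `μ t ≤ ε (T − t)`
  have key : ∀ ε : ℝ, 0 < ε → ∀ᶠ t in 𝓝[<] T, ((lam t) ^ 2)⁻¹ ≤ ε * (T - t) := by
    intro ε hε
    have hsmall : ∀ᶠ t in 𝓝[<] T, |μ' t| ≤ ε := by
      have h1 : ∀ᶠ t in 𝓝[<] T, dist (μ' t) 0 < ε := Metric.tendsto_nhds.1 hμ' ε hε
      filter_upwards [h1] with t ht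
      rw [Real.dist_eq, sub_zero] at ht
      exact ht.le
    obtain ⟨l, hlT, hsub⟩ := mem_nhdsLT_iff_exists_Ioo_subset.1 (hder.and hsmall)
    filter_upwards [Ioo_mem_nhdsLT hlT] with t ht
    have hbound : ∀ s ∈ Ioo t T, |((lam s) ^ 2)⁻¹ - ((lam t) ^ 2)⁻¹| ≤ ε * (T - t) := by
      intro s hs
      have hsI : s ∈ Ioo l T := ⟨lt_trans ht.1 hs.1, hs.2⟩
      have hmv := (convex_Ioo l T).norm_image_sub_le_of_norm_hasDerivWithin_le
        (f := fun s => ((lam s) ^ 2)⁻¹) (f' := μ')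
        (fun x hx => (hsub hx).1.hasDerivWithinAt)
        (fun x hx => by rw [Real.norm_eq_abs]; exact (hsub hx).2) ht hsI
      rw [Real.norm_eq_abs, Real.norm_eq_abs, abs_of_pos (sub_pos.2 hs.1)] at hmv
      have hst : ε * (s - t) ≤ ε * (T - t) := by nlinarith [hs.2, hε.le]
      exact hmv.trans hst
    have hlim : Tendsto (fun s => |((lam s) ^ 2)⁻¹ - ((lam t) ^ 2)⁻¹|) (𝓝[<] T)
        (𝓝 (|0 - ((lam t) ^ 2)⁻¹|)) := (hμ0.sub_const _).abs
    have hev : ∀ᶠ s in 𝓝[<] T, |((lam s) ^ 2)⁻¹ - ((lam t) ^ 2)⁻¹| ≤ ε * (T - t) := by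
      filter_upwards [Ioo_mem_nhdsLT ht.2] with s hs using hbound s hs
    have hle : |0 - ((lam t) ^ 2)⁻¹| ≤ ε * (T - t) := le_of_tendsto hlim hev
    rw [zero_sub, abs_neg] at hle
    exact (le_abs_self _).trans hle
  refine Filter.tendsto_atTop.2 fun M => ?_
  have hM : 0 < max M 1 := lt_of_lt_of_le one_pos (le_max_right _ _)
  filter_upwards [key (max M 1)⁻¹ (inv_pos.2 hM), h.eventually_pos] with t hkey hlam
  have hl2 : 0 < (lam t) ^ 2 := by positivity
  have h1 : max M 1 * ((lam t) ^ 2)⁻¹ ≤ T - t := by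
    calc max M 1 * ((lam t) ^ 2)⁻¹ ≤ max M 1 * ((max M 1)⁻¹ * (T - t)) :=
          mul_le_mul_of_nonneg_left hkey hM.le
      _ = T - t := by field_simp
  calc M ≤ max M 1 := le_max_left _ _
    _ = (lam t) ^ 2 * (max M 1 * ((lam t) ^ 2)⁻¹) := by field_simp
    _ ≤ (lam t) ^ 2 * (T - t) := mul_le_mul_of_nonneg_left h1 hl2.le

/-- For `t < T` the modulated deviation of the power law IS Chae's deviation. -/
theorem modulatedDeviation_chae {T γ : ℝ} {p : ℝ≥0} (hp : p ≠ 0)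
    (v : ℝ → EuclideanSpace ℝ (Fin 3) → EuclideanSpace ℝ (Fin 3))
    (V : EuclideanSpace ℝ (Fin 3) → EuclideanSpace ℝ (Fin 3)) {t : ℝ} (ht : t < T) :
    modulatedDeviation (chaeModulation T γ) p v V t = chaeTypeIIDeviation T γ p v V t := by
  have hd : 0 ≤ T - t := (sub_pos.2 ht).le
  have hp' : (p : ℝ) ≠ 0 := by exact_mod_cast hp
  unfold modulatedDeviation chaeModulation
  rw [chaeTypeIIDeviation_def]
  congr 2
  rw [← Real.rpow_neg hd, ← Real.rpow_mul hd]
  congr 1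
  field_simp
  ring

/-- **F4b′ is the power-law member of D9 (Kato frame)**: `Row_D9K → Row_F4bp`. PROVED. -/
theorem row_F4bp_of_row_D9K (h : Row_D9K) : Row_F4bp := by
  intro T hT p hp v π hv hK γ hγ V hV hconv hH1
  have hp3 : (3 : ℝ≥0∞) < (p : ℝ≥0∞) := three_lt_of_nineHalves_lt hp
  have hp0 : p ≠ 0 := by
    have h3 : (3 : ℝ≥0) < p := by exact_mod_cast hp3
    exact ne_of_gt (lt_trans (by norm_num) h3)
  have hdev : Tendsto (modulatedDeviation (chaeModulation T γ) p v V) (𝓝[<] T) (𝓝 0) := by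
    refine hconv.congr' ?_
    exact eventually_nhdsWithin_of_forall fun t (ht : t < T) =>
      (modulatedDeviation_chae hp0 v V ht).symm
  exact h T hT p hp3 v π hv hK (chaeModulation T γ) (isStationaryModulation_chae hγ) V hV hdev hH1

/-- **S0 holds on the power-law sub-family (bc5 witness of S0)**: for `λ = (T−t)^{−γ/2}`, `γ > 1`,
the modulated steady limit IS the tree theorem `typeII_profile_ae_eq_steadyClassicalNS`. PROVED. -/
theorem modulatedSteadyLimit_chae {T : ℝ} (hT : 0 < T) {p : ℝ≥0} (hp3 : 3 < p)
    {v : ℝ → EuclideanSpace ℝ (Fin 3) → EuclideanSpace ℝ (Fin 3)}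
    {π : ℝ → EuclideanSpace ℝ (Fin 3) → ℝ} (hv : IsClassicalNSSolutionOn (Ioo 0 T) 1 0 v π)
    {γ : ℝ} (hγ : 1 < γ) {V : EuclideanSpace ℝ (Fin 3) → EuclideanSpace ℝ (Fin 3)}
    (hV : MemLp V (p : ℝ≥0∞) volume)
    (hdev : Tendsto (modulatedDeviation (chaeModulation T γ) p v V) (𝓝[<] T) (𝓝 0)) :
    ∃ (U : EuclideanSpace ℝ (Fin 3) → EuclideanSpace ℝ (Fin 3)) (P : EuclideanSpace ℝ (Fin 3) → ℝ),
      IsSteadyClassicalNS 1 0 U P ∧ V =ᵐ[volume] U := by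
  have hp0 : p ≠ 0 := ne_of_gt (lt_trans (by norm_num) hp3)
  have hconv : Tendsto (chaeTypeIIDeviation T γ p v V) (𝓝[<] T) (𝓝 0) := by
    refine hdev.congr' ?_
    exact eventually_nhdsWithin_of_forall fun t (ht : t < T) => modulatedDeviation_chae hp0 v V ht
  exact typeII_profile_ae_eq_steadyClassicalNS hT hv hγ hp3 hV hconv

/-- **The RUNG, unconditionally, on the power-law sub-family** (`3 < p ≤ 9/2`, any `γ > 1`, no `Ḣ¹`,
no Kato / LH binder): PROVED (S0 there is a theorem; then the no-Dirichlet `L^q` Liouville lemma).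
This is LINE 15's `Row_F4bSharp` in the modulation vocabulary. -/
theorem row_D9Sharp_chae {T : ℝ} (hT : 0 < T) {p : ℝ≥0} (hp3 : 3 < p) (hp92 : (p : ℝ≥0∞) ≤ 9 / 2)
    {v : ℝ → EuclideanSpace ℝ (Fin 3) → EuclideanSpace ℝ (Fin 3)}
    {π : ℝ → EuclideanSpace ℝ (Fin 3) → ℝ} (hv : IsClassicalNSSolutionOn (Ioo 0 T) 1 0 v π)
    {γ : ℝ} (hγ : 1 < γ) {V : EuclideanSpace ℝ (Fin 3) → EuclideanSpace ℝ (Fin 3)}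
    (hV : MemLp V (p : ℝ≥0∞) volume)
    (hdev : Tendsto (modulatedDeviation (chaeModulation T γ) p v V) (𝓝[<] T) (𝓝 0)) :
    V =ᵐ[volume] 0 := by
  obtain ⟨U, P, hUP, hVU⟩ := modulatedSteadyLimit_chae hT hp3 hv hγ hV hdev
  have hUq : MemLp U (p : ℝ≥0∞) volume := hV.ae_eq hVU
  have hU0 : U = 0 := steady_eq_zero_of_memLp_superThree hUP hp3 hp92 hUq
  rw [hU0] at hVU
  exact hVU

/-- LINE 15's rung `Row_F4bSharp` (restated verbatim; the census row F4b without `Ḣ¹` / Kato). -/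
def Row_F4bSharp : Prop :=
  ∀ (T : ℝ), 0 < T → ∀ (p : ℝ≥0), 3 < p → (p : ℝ≥0∞) ≤ 9 / 2 →
    ∀ (v : ℝ → EuclideanSpace ℝ (Fin 3) → EuclideanSpace ℝ (Fin 3))
      (π : ℝ → EuclideanSpace ℝ (Fin 3) → ℝ),
    IsClassicalNSSolutionOn (Ioo 0 T) 1 0 v π →
    ∀ (γ : ℝ), 1 < γ → ∀ (V : EuclideanSpace ℝ (Fin 3) → EuclideanSpace ℝ (Fin 3)),
    MemLp V (p : ℝ≥0∞) volume → Tendsto (chaeTypeIIDeviation T γ p v V) (𝓝[<] T) (𝓝 0) →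
    V =ᵐ[volume] 0

/-- Second proof of LINE 15's rung through the modulation vocabulary; hence the census's `Row_F4b`. -/
theorem row_F4bSharp_holds' : Row_F4bSharp := by
  intro T hT p hp3 hp92 v π hv γ hγ V hV hconv
  have hp0 : p ≠ 0 := ne_of_gt (lt_trans (by norm_num) hp3)
  have hdev : Tendsto (modulatedDeviation (chaeModulation T γ) p v V) (𝓝[<] T) (𝓝 0) := by
    refine hconv.congr' ?_
    exact eventually_nhdsWithin_of_forall fun t (ht : t < T) =>
      (modulatedDeviation_chae hp0 v V ht).symm
  exact row_D9Sharp_chae hT hp3 hp92 hv hγ hV hdev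

/-- Hence the census's row F4b (`Row_F4b`, tree, already EXCLUDED) once more, through the modulation vocabulary. -/
theorem row_F4b_holds'' : Row_F4b :=
  fun T hT p hp3 hp92 v π hv _ γ hγ V hV hconv _ =>
    row_F4bSharp_holds' T hT p hp3 hp92 v π hv γ hγ V hV hconv

/-- LINE 15's LH-frame row `Row_F4bpLH` (restated verbatim; files cannot import each other). -/
@[conjecture] def Row_F4bpLH : Prop :=
  ∀ (T : ℝ), 0 < T → ∀ (p : ℝ≥0), (9 / 2 : ℝ≥0∞) < (p : ℝ≥0∞) →
    ∀ (v : ℝ → EuclideanSpace ℝ (Fin 3) → EuclideanSpace ℝ (Fin 3))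
      (π : ℝ → EuclideanSpace ℝ (Fin 3) → ℝ),
    IsClassicalNSSolutionOn (Ico 0 T) 1 0 v π → IsLerayHopfOn T 1 0 (v 0) v →
    ∀ (γ : ℝ), 1 < γ → ∀ (V : EuclideanSpace ℝ (Fin 3) → EuclideanSpace ℝ (Fin 3)),
    MemLp V (p : ℝ≥0∞) volume → Tendsto (chaeTypeIIDeviation T γ p v V) (𝓝[<] T) (𝓝 0) →
    eWeakGradL2Sq V < ⊤ → V =ᵐ[volume] 0

/-- **LINE 15's row is the power-law member of `Row_D9LH`.** PROVED. -/
theorem row_F4bpLH_of_row_D9LH (h : Row_D9LH) : Row_F4bpLH := by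
  intro T hT p hp v π hv hLH γ hγ V hV hconv hH1
  have hp3 : (3 : ℝ≥0∞) < (p : ℝ≥0∞) := three_lt_of_nineHalves_lt hp
  have hp0 : p ≠ 0 := by
    have h3 : (3 : ℝ≥0) < p := by exact_mod_cast hp3
    exact ne_of_gt (lt_trans (by norm_num) h3)
  have hdev : Tendsto (modulatedDeviation (chaeModulation T γ) p v V) (𝓝[<] T) (𝓝 0) := by
    refine hconv.congr' ?_
    exact eventually_nhdsWithin_of_forall fun t (ht : t < T) =>
      (modulatedDeviation_chae hp0 v V ht).symm
  exact h T hT p hp3 v π hv hLH (chaeModulation T γ) (isStationaryModulation_chae hγ) V hV hdev hH1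

/-! ### LINE 15's G2 `RateGate` from the CORE alone (V64 P1: ONE landing serves both lines)

On the power-law sub-family S0 is the tree theorem, so LINE 15's `RateGate` (restated VERBATIM with its
vocabulary `typeIIScale` / `typeIIField` / `typeIIRemainder` / `rateGateQuantity`) follows from the
time-free CORE `SteadyZoomDistance` ALONE: `rateGate_of_core`.  PROVED. -/

/-- LINE 15's `typeIIScale` (verbatim): `ℓ(t) = (T−t)^{γ/2}`. -/
def typeIIScale (T γ t : ℝ) : ℝ := (T - t) ^ (γ / 2)

/-- LINE 15's `typeIIField` (verbatim). -/
def typeIIField (T γ : ℝ) (V : EuclideanSpace ℝ (Fin 3) → EuclideanSpace ℝ (Fin 3)) (t : ℝ)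
    (x : EuclideanSpace ℝ (Fin 3)) : EuclideanSpace ℝ (Fin 3) :=
  (typeIIScale T γ t)⁻¹ • V ((typeIIScale T γ t)⁻¹ • x)

/-- LINE 15's `typeIIRemainder` (verbatim). -/
def typeIIRemainder (T γ : ℝ) (v : ℝ → EuclideanSpace ℝ (Fin 3) → EuclideanSpace ℝ (Fin 3))
    (V : EuclideanSpace ℝ (Fin 3) → EuclideanSpace ℝ (Fin 3)) (t : ℝ)
    (x : EuclideanSpace ℝ (Fin 3)) : EuclideanSpace ℝ (Fin 3) :=
  v t x - typeIIField T γ V t x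

/-- LINE 15's `rateGateQuantity` (verbatim): `(T−t)^{3γ/(4p)} ‖r(t)‖_{L^p}`. -/
def rateGateQuantity (T γ : ℝ) (p : ℝ≥0)
    (v : ℝ → EuclideanSpace ℝ (Fin 3) → EuclideanSpace ℝ (Fin 3))
    (V : EuclideanSpace ℝ (Fin 3) → EuclideanSpace ℝ (Fin 3)) (t : ℝ) : ℝ≥0∞ :=
  ENNReal.ofReal ((T - t) ^ (3 * γ / (4 * (p : ℝ)))) *
    eLpNorm (typeIIRemainder T γ v V t) (p : ℝ≥0∞) volume

/-- LINE 15's G2 `RateGate` (verbatim). -/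
def RateGate : Prop :=
  ∀ (T : ℝ), 0 < T → ∀ (p : ℝ≥0), (3 : ℝ≥0∞) < (p : ℝ≥0∞) →
    ∀ (v : ℝ → EuclideanSpace ℝ (Fin 3) → EuclideanSpace ℝ (Fin 3))
      (π : ℝ → EuclideanSpace ℝ (Fin 3) → ℝ),
    IsClassicalNSSolutionOn (Ico 0 T) 1 0 v π → IsLerayHopfOn T 1 0 (v 0) v →
    ∀ (γ : ℝ), 1 < γ → ∀ (V : EuclideanSpace ℝ (Fin 3) → EuclideanSpace ℝ (Fin 3)),
    MemLp V (p : ℝ≥0∞) volume → Tendsto (chaeTypeIIDeviation T γ p v V) (𝓝[<] T) (𝓝 0) →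
    liminf (rateGateQuantity T γ p v V) (𝓝[<] T) = 0 → V =ᵐ[volume] 0

/-- For `t < T` the zoom-gate quantity of the power law IS LINE 15's rate-gate quantity
(`λ^{−3/(2p)} = ((T−t)^{γ/2})^{3/(2p)} = (T−t)^{3γ/(4p)}`; the remainders agree definitionally). -/
theorem zoomGateQuantity_chae {T γ : ℝ} {p : ℝ≥0} (hp : p ≠ 0)
    (v : ℝ → EuclideanSpace ℝ (Fin 3) → EuclideanSpace ℝ (Fin 3))
    (V : EuclideanSpace ℝ (Fin 3) → EuclideanSpace ℝ (Fin 3)) {t : ℝ} (ht : t < T) :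
    zoomGateQuantity (chaeModulation T γ) p v V t = rateGateQuantity T γ p v V t := by
  have hd : 0 ≤ T - t := (sub_pos.2 ht).le
  have hp' : (p : ℝ) ≠ 0 := by exact_mod_cast hp
  unfold zoomGateQuantity chaeModulation rateGateQuantity typeIIRemainder typeIIField typeIIScale
  congr 2
  rw [← Real.rpow_neg hd, ← Real.rpow_mul hd]
  congr 1
  field_simp
  ring

/-- **LINE 15's G2 from the CORE alone.**  PROVED: S0 on power laws is the tree theorem
`typeII_profile_ae_eq_steadyClassicalNS`; then `ae_eq_zero_of_core`. -/
theorem rateGate_of_core (hC : SteadyZoomDistance) : RateGate := by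
  intro T hT p hp v π hv hLH γ hγ V hV hconv hlim
  have hp3 : (3 : ℝ≥0) < p := by exact_mod_cast hp
  have hp0 : p ≠ 0 := ne_of_gt (lt_trans (by norm_num) hp3)
  obtain ⟨U, P, hUP, hVU⟩ := typeII_profile_ae_eq_steadyClassicalNS hT
    (hv.mono Ioo_subset_Ico_self (uniqueDiffOn_Ioo 0 T)) hγ hp3 hV hconv
  have hlim' : liminf (zoomGateQuantity (chaeModulation T γ) p v V) (𝓝[<] T) = 0 := by
    rw [← hlim]
    exact liminf_congr (eventually_nhdsWithin_of_forall fun t (ht : t < T) =>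
      zoomGateQuantity_chae hp0 v V ht)
  exact ae_eq_zero_of_core hC hT hp3 hLH (isStationaryModulation_chae hγ).tendsto_atTop hV hUP hVU
    hlim'

end PowerLaw

end Summit.NavierStokesRegularity.NavierStokesRegularity.Theorems.ScenarioCensus.ModulationGate

end
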